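import Summits.SmoothPoincare4.SmoothPoincare4.Cruxes.ChangGurskyYang.SketchIdeator3

/-!
# Crux-triage r1-k2: the first lemma of card `margerin-certified-cone` is false AS TYPED

`Sketch3.MargerinPolynomialNonpos` / `MargerinPolynomialNeg` / `MargerinConeInvariant`
(Cruxes/ChangGurskyYang/SketchIdeator3.lean) quantify over ALL block triples `p : HamiltonODE.Blocks`,
with no symmetry of `A`, `C` (and no Bianchi constraint `tr A = tr C`).  Witness with an
ANTISYMMETRIC part in `A`:  `A = I + K`, `K = e₂∧e₃` (`k = e₁`), `B = 0`, `C = I`: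
`scalB = 6 > 0`, `wpNum = ‖K‖² = 2 ≤ (1/6)·36` (WP = 1/18), but along Hamilton's field
`A' = A² + 2A^# = !![5,0,0; 0,2,-4; 0,4,2]`, `C' = 3I`, so `dWpNum = 16`, `scalB' = 18` and
`dWpNum·scalB² − wpNum·(2·scalB·scalB') = 576 − 432 = 144 > 0`.
General family: `A = sI + K`, `C = sI`, `B = 0` gives `d/dt log WP = 8s − 6s = 2s > 0`.
Repair: restrict the cone to `A.IsSymm ∧ C.IsSymm ∧ A.trace = C.trace` (as in IdeasSketchR1K1/K2).
-/

open Summit.SmoothPoincare4.SmoothPoincare4.Cruxes.ChangGurskyYang.Sketch3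
open Literature.Geometry.Riemannian

noncomputable section

/-- The witness block triple `(I + K, 0, I)`. -/
def wA : Matrix (Fin 3) (Fin 3) ℝ := !![1, 0, 0; 0, 1, -1; 0, 1, 1]

def wp : HamiltonODE.Blocks := (wA, 0, 1)

theorem scalB_wp : scalB wp = 6 := by
  simp [scalB, wp, wA, Matrix.trace, Fin.sum_univ_three]
  norm_num

theorem wpNum_wp : wpNum wp = 2 := by
  simp [wpNum, wp, wA, frob, tf, Matrix.trace, Fin.sum_univ_three, Matrix.sub_apply,
    Matrix.smul_apply, Matrix.one_apply]
  norm_num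

theorem sharp_wA : Matrix.sharp wA = !![2, 0, 0; 0, 1, -1; 0, 1, 1] := by
  ext i j
  fin_cases i <;> fin_cases j <;>
    simp [Matrix.sharp, wA, Matrix.adjugate_fin_three, Matrix.transpose_apply]
  norm_num

theorem field_wp :
    HamiltonODE.field wp = (!![5, 0, 0; 0, 2, -4; 0, 4, 2], 0, (3 : ℝ) • (1 : Matrix (Fin 3) (Fin 3) ℝ)) := by
  have h1 : Matrix.sharp (1 : Matrix (Fin 3) (Fin 3) ℝ) = 1 := by
    simp [Matrix.sharp]
  have h0 : Matrix.sharp (0 : Matrix (Fin 3) (Fin 3) ℝ) = 0 := by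
    simp [Matrix.sharp, Matrix.adjugate_zero]
  simp only [HamiltonODE.field, wp, sharp_wA, h1, h0, Matrix.mul_zero,
    Matrix.transpose_zero, add_zero, smul_zero, Matrix.mul_one]
  refine Prod.ext ?_ (Prod.ext ?_ ?_)
  · ext i j
    fin_cases i <;> fin_cases j <;> norm_num [wA, Matrix.add_apply]
  · simp
  · ext i j
    fin_cases i <;> fin_cases j <;> norm_num [Matrix.add_apply, Matrix.smul_apply, Matrix.one_apply]

theorem scalB_field_wp : scalB (HamiltonODE.field wp) = 18 := by
  rw [field_wp]
  simp [scalB, Matrix.trace, Fin.sum_univ_three, Matrix.smul_apply]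
  norm_num

theorem dWpNum_wp : dWpNum wp (HamiltonODE.field wp) = 16 := by
  rw [field_wp]
  simp [dWpNum, wp, wA, frobInner, tf, Matrix.trace, Fin.sum_univ_three, Matrix.sub_apply,
    Matrix.smul_apply, Matrix.one_apply]
  norm_num

/-- **`MargerinPolynomialNonpos` (Sketch3) is false**: the polynomial is `+144` at `wp`. -/
theorem not_MargerinPolynomialNonpos : ¬ MargerinPolynomialNonpos := by
  intro h
  have key := h wp (by rw [scalB_wp]; norm_num) (by rw [wpNum_wp, scalB_wp]; norm_num)
  rw [dWpNum_wp, scalB_wp, wpNum_wp, scalB_field_wp] at key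
  norm_num at key

/-- **`MargerinPolynomialNeg` (Sketch3) is false** by the same witness (`0 < WP = 1/18 < 1/6`). -/
theorem not_MargerinPolynomialNeg : ¬ MargerinPolynomialNeg := by
  intro h
  have key := h wp (by rw [scalB_wp]; norm_num) (by rw [wpNum_wp]; norm_num)
    (by rw [wpNum_wp, scalB_wp]; norm_num)
  rw [dWpNum_wp, scalB_wp, wpNum_wp, scalB_field_wp] at key
  norm_num at key

end
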